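import Summits.CriticalPhenomena.PercolationContinuityZ3.Theorems.PercNearOneGluingNoHeavyLowerTailKnQuestion8CoefficientwiseCoreClassKernelMixDigonSlices

/-!
# Digon removal, part 3: level transport and the four summand identities

Support file (`--supports stmt-CriticalPhenomena-4575`, closed), prover `prim-cplus-coupling` (gen 70).  No definitions, no named facts, no sorries;
standard axioms.  Memo `prim-cplus-coupling/A5-COUPLING-gen70.md` §8; `THEOREM-IET-DIGON.md`.

Pointwise (per colouring) identities behind the digon removal theorem `iet_bundle_digon` (file `…KernelMixBundleDigonIET`): the level
transports `S ↦ f(S ∪ {m})` and `S ↦ f(S ∪ {m})` if `b ∈ S` else `f S` (monotone, order-preserving), and, for the four colour states of the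
digon edges, the comparison of the IET summand of the big bundle with the summand of the `r`-thread bundle (mixed states) resp. of the
chorded bundle (pure states), stated for arbitrary decidability instances so that they apply verbatim inside the sums.  Plus two `Finset`
identities for `insert`/`sdiff`.
[cite: KozmaNitzan2024, Questions 8–9 (§5.5 p. 36) (context); Harris 1960]
-/

namespace Summit.CriticalPhenomena.PercolationContinuityZ3.Theorems

open Finset Literature.Probability.Percolation

namespace Coefficientwise

variable {ι V : Type*}

/-! ### Level transport -/

/-- `S ↦ f (S ∪ {m})` is monotone. -/
theorem digon_mono_shift {f : Set V → ℝ} (hf : Monotone f) (m : V) : Monotone (fun S : Set V => f (insert m S)) :=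
  fun _ _ hST => hf (Set.insert_subset_insert hST)

open Classical in
/-- The conditional shift `S ↦ f (S ∪ {m})` if `b ∈ S`, `f S` otherwise, is monotone. -/
theorem digon_mono_cond {f : Set V → ℝ} (hf : Monotone f) (m b : V) :
    Monotone (fun S : Set V => if b ∈ S then f (insert m S) else f S) := by
  intro S T hST
  by_cases hS : b ∈ S
  · have hT : b ∈ T := hST hS
    simp only [hS, hT, if_true]
    exact hf (Set.insert_subset_insert hST)
  · by_cases hT : b ∈ T
    · simp only [hS, hT, if_true, if_false]
      exact hf (hST.trans (Set.subset_insert m T))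
    · simp only [hS, hT, if_false]
      exact hf hST

open Classical in
/-- Pointwise comparison transports: conditional ≤ shifted. -/
theorem digon_cond_le_shift {f g : Set V → ℝ} (hg : Monotone g) (hfg : ∀ S, f S ≤ g S) (m b : V) (S : Set V) :
    (if b ∈ S then f (insert m S) else f S) ≤ g (insert m S) := by
  by_cases hS : b ∈ S
  · rw [if_pos hS]; exact hfg _
  · rw [if_neg hS]; exact (hfg S).trans (hg (Set.subset_insert m S))

open Classical in
/-- Pointwise comparison transports: conditional ≤ conditional. -/
theorem digon_cond_le_cond {f g : Set V → ℝ} (hfg : ∀ S, f S ≤ g S) (m b : V) (S : Set V) :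
    (if b ∈ S then f (insert m S) else f S) ≤ (if b ∈ S then g (insert m S) else g S) := by
  by_cases hS : b ∈ S
  · rw [if_pos hS, if_pos hS]; exact hfg _
  · rw [if_neg hS, if_neg hS]; exact hfg _


open Classical in
/-- Nonnegativity transports to the conditional shift. -/
theorem digon_cond_nonneg {f : Set V → ℝ} (hf : ∀ S, 0 ≤ f S) (m b : V) (S : Set V) :
    0 ≤ (if b ∈ S then f (insert m S) else f S) := by
  by_cases hS : b ∈ S
  · rw [if_pos hS]; exact hf _
  · rw [if_neg hS]; exact hf _

/-! ### The summands in the four digon states (instance-polymorphic pointwise identities) -/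

/-- State (um red, mb blue): the summand equals the `E'`-summand with shifted X-levels and conditional Y-levels. -/
theorem digon_term_RB (P1 P : Prop) (hP : P1 ↔ P) (X1 Y1 X Y : Set V) (m b : V) (hbm : b ≠ m)
    (hX1 : X1 = insert m X) (hY1 : Y1 = Y ∪ {v | v = m ∧ b ∈ Y}) (h k ha hb ka kb : Set V → ℝ)
    [Decidable (P1 ∧ (b ∈ X1 ∧ b ∉ Y1))] [Decidable (P1 ∧ (b ∈ Y1 ∧ b ∉ X1))]
    [Decidable (P ∧ (b ∈ X ∧ b ∉ Y))] [Decidable (P ∧ (b ∈ Y ∧ b ∉ X))] [Decidable (b ∈ Y)] :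
    ((if P1 ∧ (b ∈ X1 ∧ b ∉ Y1) then h X1 * k X1 else 0) +
      (if P1 ∧ (b ∈ Y1 ∧ b ∉ X1) then (ha X1 - hb Y1) * (ka X1 - kb Y1) else 0)) =
    ((if P ∧ (b ∈ X ∧ b ∉ Y) then h (insert m X) * k (insert m X) else 0) +
      (if P ∧ (b ∈ Y ∧ b ∉ X) then
        (ha (insert m X) - (if b ∈ Y then hb (insert m Y) else hb Y)) * (ka (insert m X) - (if b ∈ Y then kb (insert m Y) else kb Y)) else 0)) := by
  subst hX1 hY1
  have e1 : b ∈ insert m X ↔ b ∈ X := by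
    rw [Set.mem_insert_iff]; exact ⟨fun h' => h'.resolve_left hbm, Or.inr⟩
  have e2 : b ∈ Y ∪ {v | v = m ∧ b ∈ Y} ↔ b ∈ Y := by
    rw [Set.mem_union, Set.mem_setOf_eq]; exact ⟨fun h' => h'.elim id fun h'' => h''.2, Or.inl⟩
  by_cases hY : b ∈ Y
  · have e3 : Y ∪ {v | v = m ∧ b ∈ Y} = insert m Y := by
      ext v; simp only [Set.mem_union, Set.mem_setOf_eq, Set.mem_insert_iff, hY, and_true]; tauto
    have vh : hb (Y ∪ {v | v = m ∧ b ∈ Y}) = hb (insert m Y) := by rw [e3]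
    have vk : kb (Y ∪ {v | v = m ∧ b ∈ Y}) = kb (insert m Y) := by rw [e3]
    rw [vh, vk]
    split_ifs <;> simp_all
  · split_ifs <;> simp_all

/-- State (um blue, mb red): the summand equals the `E'`-summand with all levels conditional. -/
theorem digon_term_BR (P1 P : Prop) (hP : P1 ↔ P) (X1 Y1 X Y : Set V) (m b : V) (hbm : b ≠ m)
    (hX1 : X1 = X ∪ {v | v = m ∧ b ∈ X}) (hY1 : Y1 = insert m Y) (h k ha hb ka kb : Set V → ℝ)
    [Decidable (P1 ∧ (b ∈ X1 ∧ b ∉ Y1))] [Decidable (P1 ∧ (b ∈ Y1 ∧ b ∉ X1))]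
    [Decidable (P ∧ (b ∈ X ∧ b ∉ Y))] [Decidable (P ∧ (b ∈ Y ∧ b ∉ X))] [Decidable (b ∈ X)] [Decidable (b ∈ Y)] :
    ((if P1 ∧ (b ∈ X1 ∧ b ∉ Y1) then h X1 * k X1 else 0) +
      (if P1 ∧ (b ∈ Y1 ∧ b ∉ X1) then (ha X1 - hb Y1) * (ka X1 - kb Y1) else 0)) =
    ((if P ∧ (b ∈ X ∧ b ∉ Y) then (if b ∈ X then h (insert m X) else h X) * (if b ∈ X then k (insert m X) else k X) else 0) +
      (if P ∧ (b ∈ Y ∧ b ∉ X) then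
        ((if b ∈ X then ha (insert m X) else ha X) - (if b ∈ Y then hb (insert m Y) else hb Y)) *
          ((if b ∈ X then ka (insert m X) else ka X) - (if b ∈ Y then kb (insert m Y) else kb Y)) else 0)) := by
  subst hX1 hY1
  have e1 : b ∈ insert m Y ↔ b ∈ Y := by
    rw [Set.mem_insert_iff]; exact ⟨fun h' => h'.resolve_left hbm, Or.inr⟩
  have e2 : b ∈ X ∪ {v | v = m ∧ b ∈ X} ↔ b ∈ X := by
    rw [Set.mem_union, Set.mem_setOf_eq]; exact ⟨fun h' => h'.elim id fun h'' => h''.2, Or.inl⟩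
  by_cases hX : b ∈ X
  · have e3 : X ∪ {v | v = m ∧ b ∈ X} = insert m X := by
      ext v; simp only [Set.mem_union, Set.mem_setOf_eq, Set.mem_insert_iff, hX, and_true]; tauto
    have v1 : h (X ∪ {v | v = m ∧ b ∈ X}) = h (insert m X) := by rw [e3]
    have v2 : k (X ∪ {v | v = m ∧ b ∈ X}) = k (insert m X) := by rw [e3]
    have v3 : ha (X ∪ {v | v = m ∧ b ∈ X}) = ha (insert m X) := by rw [e3]
    have v4 : ka (X ∪ {v | v = m ∧ b ∈ X}) = ka (insert m X) := by rw [e3]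
    rw [v1, v2, v3, v4]
    split_ifs <;> simp_all
  · have e3 : X ∪ {v | v = m ∧ b ∈ X} = X := by
      ext v; simp only [Set.mem_union, Set.mem_setOf_eq, hX, and_false, or_false]
    have v1 : h (X ∪ {v | v = m ∧ b ∈ X}) = h X := by rw [e3]
    have v2 : k (X ∪ {v | v = m ∧ b ∈ X}) = k X := by rw [e3]
    have v3 : ha (X ∪ {v | v = m ∧ b ∈ X}) = ha X := by rw [e3]
    have v4 : ka (X ∪ {v | v = m ∧ b ∈ X}) = ka X := by rw [e3]
    rw [v1, v2, v3, v4]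
    split_ifs <;> simp_all

/-- Digon fully red versus chord red: the digon summand (a supply term) dominates the chorded summand for any smaller event. -/
theorem digon_term_RR_ge (Pc P1 : Prop) (hPc : Pc → P1) (Xc1 Yc1 X1 Y1 : Set V) (m b : V)
    (hX1 : X1 = insert m Xc1) (hY1 : Y1 = Yc1) (hb : b ∈ Xc1)
    (h k ha hb' ka kb : Set V → ℝ) (hh : ∀ S, 0 ≤ h S) (hk : ∀ S, 0 ≤ k S)
    [Decidable (Pc ∧ (b ∈ Xc1 ∧ b ∉ Yc1))] [Decidable (Pc ∧ (b ∈ Yc1 ∧ b ∉ Xc1))]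
    [Decidable (P1 ∧ (b ∈ X1 ∧ b ∉ Y1))] [Decidable (P1 ∧ (b ∈ Y1 ∧ b ∉ X1))] [Decidable (b ∈ Xc1)] [Decidable (b ∈ Yc1)] :
    ((if Pc ∧ (b ∈ Xc1 ∧ b ∉ Yc1) then (if b ∈ Xc1 then h (insert m Xc1) else h Xc1) * (if b ∈ Xc1 then k (insert m Xc1) else k Xc1) else 0) +
      (if Pc ∧ (b ∈ Yc1 ∧ b ∉ Xc1) then
        ((if b ∈ Xc1 then ha (insert m Xc1) else ha Xc1) - (if b ∈ Yc1 then hb' (insert m Yc1) else hb' Yc1)) *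
          ((if b ∈ Xc1 then ka (insert m Xc1) else ka Xc1) - (if b ∈ Yc1 then kb (insert m Yc1) else kb Yc1)) else 0)) ≤
    ((if P1 ∧ (b ∈ X1 ∧ b ∉ Y1) then h X1 * k X1 else 0) +
      (if P1 ∧ (b ∈ Y1 ∧ b ∉ X1) then (ha X1 - hb' Y1) * (ka X1 - kb Y1) else 0)) := by
  subst hX1
  have hb2 : b ∈ insert m Xc1 := Set.mem_insert_of_mem _ hb
  have n2 : ¬ (Pc ∧ (b ∈ Yc1 ∧ b ∉ Xc1)) := fun h' => h'.2.2 hb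
  have n2' : ¬ (P1 ∧ (b ∈ Y1 ∧ b ∉ insert m Xc1)) := fun h' => h'.2.2 hb2
  rw [if_neg n2, if_neg n2', add_zero, add_zero, if_pos hb, if_pos hb]
  by_cases hQ : Pc ∧ (b ∈ Xc1 ∧ b ∉ Yc1)
  · have hP : P1 ∧ (b ∈ insert m Xc1 ∧ b ∉ Y1) := ⟨hPc hQ.1, hb2, by rw [hY1]; exact hQ.2.2⟩
    rw [if_pos hQ, if_pos hP]
  · rw [if_neg hQ]
    by_cases hP : P1 ∧ (b ∈ insert m Xc1 ∧ b ∉ Y1)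
    · rw [if_pos hP]; exact mul_nonneg (hh _) (hk _)
    · rw [if_neg hP]

/-- Digon fully blue versus chord blue: the summands coincide (same event, conditional levels). -/
theorem digon_term_BB (Pc P1 : Prop) (hPc : Pc ↔ P1) (X Yc1 Y1 : Set V) (m b : V)
    (hY1 : Y1 = insert m Yc1) (hb : b ∈ Yc1) (h k ha hb' ka kb : Set V → ℝ)
    [Decidable (P1 ∧ (b ∈ X ∧ b ∉ Y1))] [Decidable (P1 ∧ (b ∈ Y1 ∧ b ∉ X))]
    [Decidable (Pc ∧ (b ∈ X ∧ b ∉ Yc1))] [Decidable (Pc ∧ (b ∈ Yc1 ∧ b ∉ X))] [Decidable (b ∈ X)] [Decidable (b ∈ Yc1)] :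
    ((if P1 ∧ (b ∈ X ∧ b ∉ Y1) then h X * k X else 0) +
      (if P1 ∧ (b ∈ Y1 ∧ b ∉ X) then (ha X - hb' Y1) * (ka X - kb Y1) else 0)) =
    ((if Pc ∧ (b ∈ X ∧ b ∉ Yc1) then (if b ∈ X then h (insert m X) else h X) * (if b ∈ X then k (insert m X) else k X) else 0) +
      (if Pc ∧ (b ∈ Yc1 ∧ b ∉ X) then
        ((if b ∈ X then ha (insert m X) else ha X) - (if b ∈ Yc1 then hb' (insert m Yc1) else hb' Yc1)) *
          ((if b ∈ X then ka (insert m X) else ka X) - (if b ∈ Yc1 then kb (insert m Yc1) else kb Yc1)) else 0)) := by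
  subst hY1
  have hb2 : b ∈ insert m Yc1 := Set.mem_insert_of_mem _ hb
  have n1 : ¬ (P1 ∧ (b ∈ X ∧ b ∉ insert m Yc1)) := fun h' => h'.2.2 hb2
  have n1' : ¬ (Pc ∧ (b ∈ X ∧ b ∉ Yc1)) := fun h' => h'.2.2 hb
  rw [if_neg n1, if_neg n1', zero_add, zero_add, if_pos hb]
  by_cases hP : P1 ∧ (b ∈ insert m Yc1 ∧ b ∉ X)
  · rw [if_pos hP, if_pos ⟨hPc.mpr hP.1, hb, hP.2.2⟩, if_neg hP.2.2, if_neg hP.2.2, if_pos hb]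
  · rw [if_neg hP, if_neg (fun h' => hP ⟨hPc.mp h'.1, hb2, h'.2.2⟩)]

/-! ### Finset bookkeeping -/

/-- `insert a s \ t = insert a (s \ t)` for `a ∉ t`. -/
theorem digon_insert_sdiff [DecidableEq ι] (s t : Finset ι) (a : ι) (ha : a ∉ t) :
    insert a s \ t = insert a (s \ t) := by
  ext i
  simp only [Finset.mem_sdiff, Finset.mem_insert]
  constructor
  · rintro ⟨h1 | h1, h2⟩
    · exact Or.inl h1
    · exact Or.inr ⟨h1, h2⟩
  · rintro (rfl | ⟨h1, h2⟩)
    · exact ⟨Or.inl rfl, ha⟩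
    · exact ⟨Or.inr h1, h2⟩

/-- `insert a s \ insert a t = s \ t` for `a ∉ s`. -/
theorem digon_insert_sdiff_insert [DecidableEq ι] (s t : Finset ι) (a : ι) (ha : a ∉ s) :
    insert a s \ insert a t = s \ t := by
  ext i
  simp only [Finset.mem_sdiff, Finset.mem_insert, not_or]
  constructor
  · rintro ⟨h1 | h1, h2, h3⟩
    · exact absurd h1 h2
    · exact ⟨h1, h3⟩
  · rintro ⟨h1, h2⟩
    exact ⟨Or.inr h1, fun h => ha (h ▸ h1), h2⟩

end Coefficientwise

end Summit.CriticalPhenomena.PercolationContinuityZ3.Theorems
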